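import Literature.AlgebraicGeometry.Morphisms.FormalFunctionsModule
import Literature.AlgebraicGeometry.KTheory.PullbackVectorBundle
import HarnessLib

/-!
# Exactness of sections over affine opens for affine-localizing / coherent modules

Hartshorne II Prop. 5.6 / Görtz–Wedhorn I Thm. 7.? (the functor `Γ(V, –)` on quasi-coherent modules
over an AFFINE `V` is exact). In the tree's affine-local framework (`IsAffineLocalizing`, `Coh` of
`Morphisms/DevissageClass`; the Čech right-exactness `app_surjective_of_shortExact` of
`Morphisms/CechModuleShortExact`; `Morphisms/FormalFunctionsModule.exists_app_eq_of_app_cokernel_π_eq_zero`)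
this file records the forms consumed by the coherent formal-module bricks:

* `app_surjective_of_epi` — an EPIMORPHISM `φ : M → N` between affine-localizing modules is
  surjective on sections over every affine open (its kernel is affine-localizing);
  (a monomorphism is injective on sections over every open: tree `KTheory.app_injective_of_mono`);
* `exists_app_eq_of_exact` — for an EXACT pair `M₁ → M₂ → M₃` with `M₁`, `M₂` coherent (on a locally
  noetherian scheme), a section of `M₂` over an affine `V` dying in `M₃` comes from `M₁` (the induced
  `coker → M₃` is a monomorphism, then right exactness of `M₁ → M₂ → coker`);
* `exists_eq_globalScalar_smul_of_app_eq_zero` — the case of the complex `M —a→ M —π→ M'` (exact, `M` coherent):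
  a section of `M` over an affine dying under `π` is `a •` a section.

Everything is proved; no named facts.

## References

* R. Hartshorne, *Algebraic Geometry*, GTM 52 (1977), II Prop. 5.6 (p. 113). [Hartshorne1977]
* U. Görtz, T. Wedhorn, *Algebraic Geometry II* (2023), Thm. 22.2 (cohomology of quasi-coherent modules
  on affine schemes vanishes). [GortzWedhorn2023]
-/

noncomputable section

open CategoryTheory AlgebraicGeometry Limits TopologicalSpace Opposite
open Literature.AlgebraicGeometry.Modules

universe u

namespace Literature.AlgebraicGeometry.Morphisms

variable {X : Scheme.{u}}

/-- **`0 → ker φ → M → N → 0` is short exact for an epimorphism `φ`.** [folklore] -/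
theorem shortExact_kernel_of_epi {M N : X.Modules} (φ : M ⟶ N) [Epi φ] :
    (ShortComplex.mk (kernel.ι φ) φ (kernel.condition φ)).ShortExact :=
  ShortComplex.ShortExact.mk' (ShortComplex.exact_kernel φ) inferInstance inferInstance

/-- **An epimorphism of affine-localizing modules is surjective on sections over affine opens**
(its kernel is affine-localizing, `IsAffineLocalizing.kernel`, and `Γ(V, –)` is right exact on short
exact sequences with affine-localizing kernel, `app_surjective_of_shortExact`).
[cite: Hartshorne1977, II Prop. 5.6 (p. 113)] -/
theorem app_surjective_of_epi {M N : X.Modules} (φ : M ⟶ N) [Epi φ] (hM : IsAffineLocalizing M)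
    (hN : IsAffineLocalizing N) {V : X.Opens} (hV : IsAffineOpen V) :
    Function.Surjective (φ.app V) :=
  app_surjective_of_shortExact (shortExact_kernel_of_epi φ) (IsAffineLocalizing.kernel φ hM hN) hV

/-- **Exactness of sections over an affine for an exact pair with coherent left terms**: if
`M₁ —f→ M₂ —g→ M₃` is exact with `M₁`, `M₂` coherent (locally noetherian `X`) and `V` is affine, a
section `y ∈ Γ(V, M₂)` with `g(y) = 0` is `f(x)` for some `x ∈ Γ(V, M₁)`: the induced map
`coker f → M₃` is a monomorphism (exactness), so `y` dies in `Γ(V, coker f)`, and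
`Γ(V, M₁) → Γ(V, M₂) → Γ(V, coker f)` is exact (`exists_app_eq_of_app_cokernel_π_eq_zero`).
[cite: Hartshorne1977, II Prop. 5.6 (p. 113)] -/
theorem exists_app_eq_of_exact [IsLocallyNoetherian X] {S : ShortComplex X.Modules} (hS : S.Exact)
    (h₁ : Coh S.X₁) (h₂ : Coh S.X₂) {V : X.Opens} (hV : IsAffineOpen V) (y : Γ(S.X₂, V))
    (hy : S.g.app V y = 0) : ∃ x : Γ(S.X₁, V), S.f.app V x = y := by
  haveI := hS.mono_cokernelDesc
  have h0 : (cokernel.π S.f).app V y = 0 := by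
    apply KTheory.app_injective_of_mono (cokernel.desc S.f S.g S.zero) V
    rw [map_zero]
    change (cokernel.π S.f ≫ cokernel.desc S.f S.g S.zero).app V y = 0
    rw [cokernel.π_desc, hy]
  exact exists_app_eq_of_app_cokernel_π_eq_zero S.f h₁ h₂ hV y h0

/-- **The complex `M —a→ M —π→ M'`**: if it is exact with `M` coherent, a section of `M` over an
affine `V` dying under `π` is `a|_V •` a section (`a` a global function).
[cite: Hartshorne1977, II Prop. 5.6 (p. 113)] -/
theorem exists_eq_globalScalar_smul_of_app_eq_zero [IsLocallyNoetherian X] {M M' : X.Modules} (a : Γ(X, ⊤))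
    (π : M ⟶ M') (w : globalScalar M a ≫ π = 0) (hex : (ShortComplex.mk (globalScalar M a) π w).Exact)
    (hM : Coh M) {V : X.Opens} (hV : IsAffineOpen V) (y : Γ(M, V)) (hy : π.app V y = 0) :
    ∃ x : Γ(M, V), X.presheaf.map (homOfLE (le_top : V ≤ ⊤)).op a • x = y := by
  obtain ⟨x, hx⟩ := exists_app_eq_of_exact hex hM hM hV y hy
  exact ⟨x, by rw [← globalScalar_app_apply]; exact hx⟩

/-- The transition data of a coherent formal module in the quotient model, read on an affine open:
if `M —a→ M —π→ M'` is exact with `π` an epimorphism and `M`, `M'` coherent, then on every affine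
`V` the map `π_V : Γ(V, M) → Γ(V, M')` is surjective with kernel `a|_V · Γ(V, M)`.
[cite: GortzWedhorn2023, (24.18.1) and Prop. 24.88 (p. 562)] -/
theorem app_surjective_and_ker_of_exact_of_epi [IsLocallyNoetherian X] {M M' : X.Modules}
    (a : Γ(X, ⊤)) (π : M ⟶ M') [Epi π] (w : globalScalar M a ≫ π = 0)
    (hex : (ShortComplex.mk (globalScalar M a) π w).Exact) (hM : Coh M) (hM' : Coh M')
    {V : X.Opens} (hV : IsAffineOpen V) :
    Function.Surjective (π.app V) ∧
      ∀ y : Γ(M, V), π.app V y = 0 ↔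
        ∃ x : Γ(M, V), X.presheaf.map (homOfLE (le_top : V ≤ ⊤)).op a • x = y := by
  refine ⟨app_surjective_of_epi π hM.loc hM'.loc hV, fun y => ⟨fun hy => ?_, ?_⟩⟩
  · exact exists_eq_globalScalar_smul_of_app_eq_zero a π w hex hM hV y hy
  · rintro ⟨x, rfl⟩
    rw [← globalScalar_app_apply]
    change (globalScalar M a ≫ π).app V x = 0
    rw [w]
    rfl

end Literature.AlgebraicGeometry.Morphisms

end
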